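import Mathlib
import HarnessLib

/-!
# `HeteroclinicTriggerChain` — crux `TriggerChainFrontStep` (item stmt-NavierStokesRegularity-22785):
  the PASSAGE-TIME LAW of the complete-transfer arc (layer-2 child "passage lemma", exact-arc case)

The route text lists as NOT DECOMPOSED "the quantitative saddle-passage lemma (entry seed δ ↦ exit after
log(h/δ)/e …)". On the exact three-mode arc of the trigger-chain table (rates `e = g`),
`x′ = −eu²`, `u′ = exu − euy`, `y′ = eu²` on the invariant circle `x + y = 1`, `x² + u² + y² = 1`, the
receiver obeys the logistic law `y′ = 2e·y(1−y)` and — proved here WITHOUT an appeal to ODE uniqueness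
(a Lyapunov-weight argument on the defect `D = y − (1−y)·C·exp(2et)`) — is given in CLOSED FORM
`y(t) = y₀ e^{2et} / ((1−y₀) + y₀ e^{2et})` for all real `t` (`heteroclinicTriggerChain_arc_logistic`).
Consequences: the level-`ℓ` passage time is `T = log(ℓ(1−y₀)/((1−ℓ)y₀)) / (2e)`
(`heteroclinicTriggerChain_arc_passageTime`), and for a pre-transfer state (`y₀ ≤ 1/2`) with trigger seed
`u₀` the half-transfer delay `T½ = log((1−y₀)/y₀)/(2e)` obeys `|T½ − log(1/|u₀|)/e| ≤ log 2/(2e)`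
(`heteroclinicTriggerChain_arc_halfTransfer_delay`): the DELAY `log(1/δ)/e + O(1)` of the card, with the
explicit `O(1) = ±log 2/(2e)`.

HONEST FRAMING: elementary facts about a three-dimensional quadratic ODE (the two-shell truncation of the
route's table); helper for the crux, no stub credit; nothing here is a statement about the Navier–Stokes
equations; no summit, rung or crux is proved by this file.
-/

noncomputable section

set_option linter.dupNamespace false

open Real

namespace Summit.NavierStokesRegularity.NavierStokesRegularity.Theorems

/-- **Closed form of the complete-transfer arc.** For `e > 0` and a solution `(x,u,y)` of
`x′ = −eu²`, `u′ = exu − euy`, `y′ = eu²` with `x 0 + y 0 = 1`, `x 0² + u 0² + y 0² = 1`, `u 0 ≠ 0`: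
`0 < y 0 < 1` and `y t · ((1 − y 0) + y 0 · exp (2et)) = y 0 · exp (2et)` for every real `t`
(the logistic law `y′ = 2e y(1−y)` integrated; no uniqueness theorem is used). [folklore] -/
theorem heteroclinicTriggerChain_arc_logistic (e : ℝ) (he : 0 < e) (x u y : ℝ → ℝ)
    (hx : ∀ t, HasDerivAt x (-(e * u t ^ 2)) t)
    (hu : ∀ t, HasDerivAt u (e * x t * u t - e * u t * y t) t)
    (hy : ∀ t, HasDerivAt y (e * u t ^ 2) t) (hL : x 0 + y 0 = 1)
    (hE : x 0 ^ 2 + u 0 ^ 2 + y 0 ^ 2 = 1) (hu0 : u 0 ≠ 0) :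
    0 < y 0 ∧ y 0 < 1 ∧
      ∀ t, y t * ((1 - y 0) + y 0 * Real.exp (2 * e * t)) = y 0 * Real.exp (2 * e * t) := by
  -- conservation of x + y
  have hLt : ∀ t, x t + y t = 1 := by
    have hd : Differentiable ℝ (x + y) := fun t => ((hx t).add (hy t)).differentiableAt
    have hd' : ∀ t, deriv (x + y) t = 0 := fun t => by
      rw [((hx t).add (hy t)).deriv]; ring
    intro t
    have h := is_const_of_deriv_eq_zero hd hd' t 0
    simp only [Pi.add_apply] at h
    linarith
  -- conservation of the energy
  have hEt : ∀ t, x t ^ 2 + u t ^ 2 + y t ^ 2 = 1 := by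
    have hder : ∀ t, HasDerivAt (x ^ 2 + (u ^ 2 + y ^ 2))
        (↑(2 : ℕ) * x t ^ (2 - 1) * (-(e * u t ^ 2)) + (↑(2 : ℕ) * u t ^ (2 - 1) * (e * x t * u t - e * u t * y t) +
          ↑(2 : ℕ) * y t ^ (2 - 1) * (e * u t ^ 2))) t := fun t =>
      ((hx t).pow 2).add (((hu t).pow 2).add ((hy t).pow 2))
    have hd : Differentiable ℝ (x ^ 2 + (u ^ 2 + y ^ 2)) := fun t => (hder t).differentiableAt
    have hd' : ∀ t, deriv (x ^ 2 + (u ^ 2 + y ^ 2)) t = 0 := fun t => by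
      rw [(hder t).deriv]
      norm_num
      ring
    intro t
    have h := is_const_of_deriv_eq_zero hd hd' t 0
    simp only [Pi.add_apply, Pi.pow_apply] at h
    linarith
  -- logistic reduction
  have hu2 : ∀ t, u t ^ 2 = 2 * y t * (1 - y t) := fun t => by
    have h := hEt t
    have hx_eq : x t = 1 - y t := by linarith [hLt t]
    rw [hx_eq] at h
    nlinarith [h]
  have hprod : ∀ t, 0 ≤ y t * (1 - y t) := fun t => by nlinarith [hu2 t, sq_nonneg (u t)]
  have hy_le : ∀ t, y t ≤ 1 := fun t => by nlinarith [hprod t]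
  have hy_ge : ∀ t, 0 ≤ y t := fun t => by nlinarith [hprod t]
  have hprod0 : 0 < y 0 * (1 - y 0) := by
    have h : 0 < u 0 ^ 2 := by positivity
    nlinarith [hu2 0]
  have hy0 : 0 < y 0 := by nlinarith [hprod0, hy_le 0]
  have hy1 : y 0 < 1 := by nlinarith [hprod0, hy_ge 0]
  have hderiv : ∀ t, HasDerivAt y (2 * e * (y t * (1 - y t))) t := fun t => by
    have h := hy t
    rw [hu2 t] at h
    convert h using 1
    ring
  refine ⟨hy0, hy1, ?_⟩
  -- the defect D = y (1 + C e^{2et}) - C e^{2et}, C = y₀/(1-y₀), obeys D' = 2e(1-y) D, D 0 = 0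
  have h1y0 : 0 < 1 - y 0 := by linarith
  obtain ⟨C, hC⟩ : ∃ C : ℝ, C = y 0 / (1 - y 0) := ⟨_, rfl⟩
  obtain ⟨D, hD⟩ : ∃ D : ℝ → ℝ,
      ∀ s, D s = y s * (1 + C * Real.exp (2 * e * s)) - C * Real.exp (2 * e * s) := ⟨_, fun _ => rfl⟩
  have hD0 : D 0 = 0 := by
    rw [hD, hC]
    simp only [mul_zero, Real.exp_zero, mul_one]
    field_simp
    ring
  have hexp : ∀ (a t : ℝ), HasDerivAt (fun s => Real.exp (a * s)) (Real.exp (a * t) * a) t :=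
    fun a t => by
      have h := ((hasDerivAt_id t).const_mul a).exp
      simpa using h
  have hDder : ∀ t, HasDerivAt D (2 * e * (1 - y t) * D t) t := by
    intro t
    have h := ((hderiv t).mul (((hexp (2 * e) t).const_mul C).const_add 1)).sub
      ((hexp (2 * e) t).const_mul C)
    have h' : HasDerivAt (fun s => y s * (1 + C * Real.exp (2 * e * s)) - C * Real.exp (2 * e * s))
        (2 * e * (1 - y t) * D t) t := h.congr_deriv (by rw [hD]; ring)
    exact h'.congr_of_eventuallyEq (Filter.Eventually.of_forall fun s => hD s)
  have hDsq : ∀ t, HasDerivAt (fun s => D s * D s) (2 * (2 * e * (1 - y t)) * (D t * D t)) t :=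
    fun t => ((hDder t).mul (hDder t)).congr_deriv (by ring)
  -- forward in time `D² e^{-4et}` is antitone, backward in time `D² e^{4et}` is monotone
  have hG : Antitone fun s => D s * D s * Real.exp (-(4 * e) * s) := by
    have hder : ∀ t, HasDerivAt (fun s => D s * D s * Real.exp (-(4 * e) * s))
        (2 * (2 * e * (1 - y t)) * (D t * D t) * Real.exp (-(4 * e) * t) +
          D t * D t * (Real.exp (-(4 * e) * t) * (-(4 * e)))) t :=
      fun t => (hDsq t).mul (hexp (-(4 * e)) t)
    refine antitone_of_deriv_nonpos (fun t => (hder t).differentiableAt) fun t => ?_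
    rw [(hder t).deriv]
    have h2 : 2 * (2 * e * (1 - y t)) * (D t * D t) * Real.exp (-(4 * e) * t) +
        D t * D t * (Real.exp (-(4 * e) * t) * (-(4 * e))) =
        -(4 * e * y t * (D t * D t * Real.exp (-(4 * e) * t))) := by ring
    rw [h2, neg_nonpos]
    have h3 := hy_ge t
    have h4 : 0 ≤ D t * D t := mul_self_nonneg _
    positivity
  have hH : Monotone fun s => D s * D s * Real.exp ((4 * e) * s) := by
    have hder : ∀ t, HasDerivAt (fun s => D s * D s * Real.exp ((4 * e) * s))
        (2 * (2 * e * (1 - y t)) * (D t * D t) * Real.exp ((4 * e) * t) +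
          D t * D t * (Real.exp ((4 * e) * t) * (4 * e))) t :=
      fun t => (hDsq t).mul (hexp (4 * e) t)
    refine monotone_of_deriv_nonneg (fun t => (hder t).differentiableAt) fun t => ?_
    rw [(hder t).deriv]
    have h2 : 2 * (2 * e * (1 - y t)) * (D t * D t) * Real.exp ((4 * e) * t) +
        D t * D t * (Real.exp ((4 * e) * t) * (4 * e)) =
        (4 * e * (1 - y t) + 4 * e) * (D t * D t * Real.exp ((4 * e) * t)) := by ring
    rw [h2]
    have h5 : 0 ≤ 1 - y t := by linarith [hy_le t]
    have h4 : 0 ≤ D t * D t := mul_self_nonneg _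
    positivity
  have hDzero : ∀ t, D t = 0 := by
    intro t
    have hsq : D t * D t ≤ 0 := by
      rcases le_total 0 t with ht | ht
      · have h := hG ht
        simp only [hD0, mul_zero, zero_mul] at h
        exact le_of_mul_le_mul_right (by simpa using h) (Real.exp_pos (-(4 * e) * t))
      · have h := hH ht
        simp only [hD0, mul_zero, zero_mul] at h
        exact le_of_mul_le_mul_right (by simpa using h) (Real.exp_pos ((4 * e) * t))
    exact mul_self_eq_zero.1 (le_antisymm hsq (mul_self_nonneg _))
  intro t
  have h := hDzero t
  rw [hD, hC] at h
  field_simp at h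
  linarith [h]

/-- **Passage time across level `ℓ`.** In the setting of `heteroclinicTriggerChain_arc_logistic`, for
`0 < ℓ < 1` the receiver crosses the level `ℓ` exactly at
`T = log (ℓ(1 − y 0) / ((1 − ℓ) · y 0)) / (2e)`. [folklore] -/
theorem heteroclinicTriggerChain_arc_passageTime (e : ℝ) (he : 0 < e) (x u y : ℝ → ℝ)
    (hx : ∀ t, HasDerivAt x (-(e * u t ^ 2)) t)
    (hu : ∀ t, HasDerivAt u (e * x t * u t - e * u t * y t) t)
    (hy : ∀ t, HasDerivAt y (e * u t ^ 2) t) (hL : x 0 + y 0 = 1)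
    (hE : x 0 ^ 2 + u 0 ^ 2 + y 0 ^ 2 = 1) (hu0 : u 0 ≠ 0) {ℓ : ℝ} (hℓ0 : 0 < ℓ) (hℓ1 : ℓ < 1)
    (T : ℝ) :
    y T = ℓ ↔ T = Real.log (ℓ * (1 - y 0) / ((1 - ℓ) * y 0)) / (2 * e) := by
  obtain ⟨hy0, hy1, hform⟩ := heteroclinicTriggerChain_arc_logistic e he x u y hx hu hy hL hE hu0
  have hT := hform T
  have hpos : 0 < (1 - y 0) + y 0 * Real.exp (2 * e * T) := by
    have := Real.exp_pos (2 * e * T); nlinarith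
  constructor
  · intro hyT
    rw [hyT] at hT
    -- exp (2eT) = ℓ(1-y0)/((1-ℓ) y0)
    have hne : (1 - ℓ) * y 0 ≠ 0 := by apply mul_ne_zero <;> linarith
    have hexp : Real.exp (2 * e * T) = ℓ * (1 - y 0) / ((1 - ℓ) * y 0) := by
      rw [eq_div_iff hne]
      linear_combination -hT
    rw [← hexp, Real.log_exp]
    have h2e : (2 : ℝ) * e ≠ 0 := by positivity
    exact (mul_div_cancel_left₀ T h2e).symm
  · intro hTeq
    have harg : 0 < ℓ * (1 - y 0) / ((1 - ℓ) * y 0) := by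
      apply div_pos <;> apply mul_pos <;> linarith
    have hexp : Real.exp (2 * e * T) = ℓ * (1 - y 0) / ((1 - ℓ) * y 0) := by
      rw [hTeq, show 2 * e * (Real.log (ℓ * (1 - y 0) / ((1 - ℓ) * y 0)) / (2 * e)) =
        Real.log (ℓ * (1 - y 0) / ((1 - ℓ) * y 0)) by field_simp, Real.exp_log harg]
    have hℓne : 1 - ℓ ≠ 0 := by linarith
    have hy0ne : y 0 ≠ 0 := hy0.ne'
    have h1y0ne : 1 - y 0 ≠ 0 := by linarith
    have hden : 1 - y 0 + y 0 * Real.exp (2 * e * T) = (1 - y 0) / (1 - ℓ) := by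
      rw [hexp]
      field_simp
      ring
    have hnum : y 0 * Real.exp (2 * e * T) = ℓ * (1 - y 0) / (1 - ℓ) := by
      rw [hexp]
      field_simp
    rw [hden, hnum, ← mul_div_assoc, div_left_inj' hℓne] at hT
    exact mul_right_cancel₀ h1y0ne hT

/-- **The delay law `log(1/δ)/e + O(1)`.** In the same setting, if the state is pre-transfer
(`y 0 ≤ 1/2`, i.e. the carrier still holds at least half the energy share) then the half-transfer time
`T½ := log ((1 − y 0)/y 0) / (2e)` (the unique time with `y T½ = 1/2`) satisfies
`|T½ − log (1/|u 0|) / e| ≤ log 2 / (2e)`: the trigger seed `δ = |u 0|` delays the hop by `log(1/δ)/e`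
up to the explicit constant `log 2/(2e)`. [folklore] -/
theorem heteroclinicTriggerChain_arc_halfTransfer_delay (e : ℝ) (he : 0 < e) (x u y : ℝ → ℝ)
    (hx : ∀ t, HasDerivAt x (-(e * u t ^ 2)) t)
    (hu : ∀ t, HasDerivAt u (e * x t * u t - e * u t * y t) t)
    (hy : ∀ t, HasDerivAt y (e * u t ^ 2) t) (hL : x 0 + y 0 = 1)
    (hE : x 0 ^ 2 + u 0 ^ 2 + y 0 ^ 2 = 1) (hu0 : u 0 ≠ 0) (hhalf : y 0 ≤ 1 / 2) :
    y (Real.log ((1 - y 0) / y 0) / (2 * e)) = 1 / 2 ∧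
      |Real.log ((1 - y 0) / y 0) / (2 * e) - Real.log (1 / |u 0|) / e| ≤ Real.log 2 / (2 * e) := by
  obtain ⟨hy0, hy1, -⟩ := heteroclinicTriggerChain_arc_logistic e he x u y hx hu hy hL hE hu0
  have hpass := heteroclinicTriggerChain_arc_passageTime e he x u y hx hu hy hL hE hu0
    (ℓ := 1 / 2) (by norm_num) (by norm_num) (Real.log ((1 - y 0) / y 0) / (2 * e))
  have harg : (1 / 2 : ℝ) * (1 - y 0) / ((1 - 1 / 2) * y 0) = (1 - y 0) / y 0 := by
    rw [div_eq_div_iff (by positivity) hy0.ne']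
    ring
  rw [harg] at hpass
  refine ⟨hpass.2 rfl, ?_⟩
  -- y0 (1 - y0) = u0²/2 with 1/2 ≤ 1 - y0 ≤ 1: u0²/2 ≤ y0 ≤ u0², so (1-y0)/y0 ∈ [1/(2u0²), 2/u0²]... in logs
  have hu2 : u 0 ^ 2 = 2 * y 0 * (1 - y 0) := by
    have hx0 : x 0 = 1 - y 0 := by linarith
    rw [hx0] at hE
    nlinarith [hE]
  have hua : 0 < |u 0| := abs_pos.2 hu0
  have hu2' : |u 0| ^ 2 = 2 * y 0 * (1 - y 0) := by rw [sq_abs]; exact hu2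
  -- express everything through logs
  have hlog_ratio : Real.log ((1 - y 0) / y 0) = Real.log (1 - y 0) - Real.log (y 0) :=
    Real.log_div (by linarith) hy0.ne'
  have hlog_u : Real.log (1 / |u 0|) = -Real.log (|u 0|) := by
    rw [one_div, Real.log_inv]
  have hlog_usq : 2 * Real.log (|u 0|) = Real.log 2 + Real.log (y 0) + Real.log (1 - y 0) := by
    have h : Real.log (|u 0| ^ 2) = Real.log (2 * y 0 * (1 - y 0)) := by rw [hu2']
    rw [Real.log_pow, Real.log_mul (by positivity) (by linarith), Real.log_mul (by norm_num) hy0.ne']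
      at h
    push_cast at h
    linarith
  -- bounds on log(1 - y0): log(1/2) ≤ log(1-y0) ≤ 0
  have hl1 : Real.log (1 - y 0) ≤ 0 := Real.log_nonpos (by linarith) (by linarith)
  have hl2 : -Real.log 2 ≤ Real.log (1 - y 0) := by
    rw [← Real.log_inv]
    exact Real.log_le_log (by norm_num) (by linarith)
  have h2e : 0 < 2 * e := by positivity
  have hA : 2 * e * (Real.log ((1 - y 0) / y 0) / (2 * e) - Real.log (1 / |u 0|) / e) =
      2 * Real.log (1 - y 0) + Real.log 2 := by
    have h1 : 2 * e * (Real.log ((1 - y 0) / y 0) / (2 * e) - Real.log (1 / |u 0|) / e) =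
        Real.log ((1 - y 0) / y 0) - 2 * Real.log (1 / |u 0|) := by
      field_simp
    rw [h1, hlog_ratio, hlog_u]
    linarith
  rw [abs_le]
  constructor
  · rw [← neg_div, div_le_iff₀ h2e]
    linarith
  · rw [le_div_iff₀ h2e]
    linarith

end Summit.NavierStokesRegularity.NavierStokesRegularity.Theorems

end
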